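import Literature.MathematicalPhysics.QuantumFieldTheory.Balaban1983to89.Node00.Record12BgRowGaugeGradient

/-!
# NODE 00 — ROW P11: the (1.12)∕(2.38) derivative members `h3I`∕`h3MS` of the faithful chain SUPPLIED from ONE covariant C¹ class datum —
# the row's body at a separated sequence from [15] Thm 1 (8) (named fact) + the C¹ class bound (displayed) + letters, no gauge-potential hypothesis left

Cell `pub-ymgap`, seat `pub-ymgap-node00-def-P11` g2 (R218 ∕ OPS-NOTE-16; INTENT-7 INBOX l.16599), sequel of `Record12BgRowGaugeGradient` (p501557, the comb-gauge gradient
lemma).  [I] = [Balaban1987RG1]; [III] = [Balaban1988Convergent]; [15] = [Balaban1985Variational].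

HONEST FRAMING.  Bookkeeping (cube ∕ box geometry of def-R's partitions) + elementary real inequalities over the comb-gauge gradient lemma; ONE displayed class hypothesis
(`PlaqC1SmallOn (plaqInside (Ω_n)) (b′_n·η_n³) U` — the located gauge-free reading of [15] Thm 1 (9)–(10), never asserted); nothing of Bałaban asserted or discharged;
K0‴ NOT closed; counts unmoved (typed 28∕28 · discharged 5∕28); one finite `𝕋⁴` torus family at fixed `ε = L^{−K}`; not continuum ∕ OS ∕ mass gap ∕ Clay.  No `def`,
no `instance`, no `sorry`.

WHAT THIS FILE PROVES.  FILE 5 v1.2 ★★★ `bgRowAt_of_thm1ScaledSep` (= node00-def-K0a 11b `bgSep_of_thm1ScaledSep` lifted to θ) reaches the body of `BgProvisoΛ` at a separated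
sequence from `VariationalThm1ScaledSep` + numerics + (C1)(C2) + no wrapping + TWO DISPLAYED HYPOTHESES `h3I`∕`h3MS` on the GRADIENT OF THE AXIAL POTENTIAL of def-R's background on
the cubes of record (the derivative members of (1.12) [I] p. 262 and (2.38) [III] p. 261).  Here `h3I`∕`h3MS` are THEOREMS (`h3I_of_plaqC1`, `h3MS_of_plaqC1`) given the
plaquette class bound `|∂U − 1| < b_n·η_n²` on the plaquettes touching `Ω_n` (already supplied by the named fact) AND a covariant C¹ class datum `< b′_n·η_n³` on adjacent
plaquettes INSIDE `Ω_n` (`PlaqC1SmallOn (plaqInside (Ω n))`, gauge invariant), chart reachability, and the scale-free letters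
`4(b_j + (d−1)LM·b′_j + 4(d−1)²L²M²·b_j²) < O(1)LMB·α_{0,j}` (1.12), `4(b_n + (d−1)M·b′_n + 4(d−1)²M²·b_n²) < rad238·α_{0,n}` (2.38).  Hence ★★ `bgRowAt_of_classBoundsC1`
(the row's body from the two class bounds, any source) and ★★★ `bgRowAt_of_thm1ScaledSepC1` (from `VariationalThm1ScaledSep` for (8) + the displayed C¹ datum
`B₃′·cR·ε_n·η_n³`): compared with FILE 5 v1.2 the gauge-potential hypotheses are GONE; what the row costs beyond kernel bookkeeping is now (R1′) [15] Thm 1 (8)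
(per-scale, separated, comparable — `VariationalThm1ScaledSep`) and (R2′) ONE C¹ class clause in the same currency ([15] Thm 1 (9)–(10)), plus letters and the run
conditions (hcomp), (C1), (C2).  LOCATED FLOOR (cf. ref-H READ-82 `2L² ≤ B₃`): at `n = 1` the data outside `Ω_1` are the un-averaged scale-0 field, so near `∂Ω_1` the
minimiser is only as smooth as the data one lattice step away; the C¹ clause on `plaqInside (Ω_1)` is plausibly inhabited only for `B₃′ ≳ 2L³` (an `L`-dependent constant,
print-consistent: «B₃ depends on d and L only») — consumers display `B₃′` as a parameter.

CONTENTS.  §4 `exists_boxPoint_of_dpair` (a derivative triple of `□ ∩ Y` in a non-wrapping cube is a box pair), `boxPlaqs_subset_plaqInside`, `norm_grad_axialPotential_cube_le`,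
`scale_algebra`, ★ `h3I_of_plaqC1`, ★ `h3MS_of_plaqC1`.  §5 `hsmall_side_of_LM`, `hsmall_side_of_M`, ★★ `bgRowAt_of_classBoundsC1`, ★★★ `bgRowAt_of_thm1ScaledSepC1`.

DEPENDENCES (by name): FILE 7a `norm_grad_axialPotential_le`, `PlaqC1SmallOn(.mono)`, `e_apply_nonneg`, `le_add_e`; FILE 4 `axialPotential`, `boxLo`∕`boxHi`∕`boxHi_le`,
`cubeEnl_zero_eq`, `mem_boxBonds_of_src_tgt_mem`, `boxPlaqs_subset_plaqsOf`, `side_pred_mul_eta_le(')`, `L_pow_mul_eta`; FILE 5 `bgRowAt_of_classBounds`, `hcubeΩ_of_compatible`;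
FILE 2 `plaqSmallOn_UbgMSOfRecord_of_thm1ScaledSep`, `VariationalThm1ScaledSep`, `Sect2.SeqSeparated`; pv26 `castSite(_add_e)`, `boxPlaqs`, `castSite_injOn_box`;
def-R `plaqInside`, `UbgMSOfRecord`, `regSuppOfRecord`, `omegaPlaqs_of_ne_zero`; r11 `grad`, `rad238`, `Sect2.(regionOfSet, domSites, spaceI, spaceMS, admB)`.
-/

noncomputable section

open scoped Matrix.Norms.L2Operator

namespace Literature.MathematicalPhysics.QuantumFieldTheory.Balaban1983to89.Node00

open T4Continuum B14.Eq218Concrete B15DeterminingSets B12RegularSpaces111 B14RegularSpaces234 B14Radii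
open T4AxialGaugeSmallField (castSite castSite_add_e boxPlaqs boxBonds castSite_injOn_box)
open B7Prop1Explicit (e e_apply)

/-! ## §4  The cubes of record: a derivative pair inside a non-wrapping cube is a box pair; the gradient bound on the cube; the two scaled forms -/

section Cubes

variable {N : ℕ} [NeZero N] {P : Params}

/-- **A DERIVATIVE TRIPLE `(x, ν, μ)` OF A REGION INSIDE A NON-WRAPPING CUBE IS A BOX PAIR**: its four corners `x, x+e_ν, x+e_μ, x+e_ν+e_μ` lie in the cube,
so `x = castSite z` with `lo ≤ z`, `z + e_μ + e_ν ≤ hi` (two applications of FILE 4's `mem_boxBonds_of_src_tgt_mem` and injectivity of the projection on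
the box). [cite: Balaban1987RG1, (1.12) p.262 (bookkeeping)] -/
theorem exists_boxPoint_of_dpair {s : ℕ} (hsN : (s : ℤ) < P.sitesPerDir 0) (a : Fin P.d → ℤ) {Y : Set (Site P 0)}
    {q : Site P 0 × Fin P.d × Fin P.d} (hq : q ∈ (Sect2.regionOfSet P (cubeEnl P s a 0 ∩ Y)).dpairs) :
    ∃ z : Fin P.d → ℤ, boxLo s a ≤ z ∧ z + e q.2.2 + e q.2.1 ≤ boxHi s a ∧ q.1 = castSite z := by
  obtain ⟨h1, h2, h3, h4⟩ := hq
  have hN : ∀ κ, boxHi s a κ - boxLo s a κ < P.sitesPerDir 0 := fun κ => by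
    have := boxHi_le s a κ; omega
  obtain ⟨z, hz, hzν, hsrc⟩ := mem_boxBonds_of_src_tgt_mem hsN a (b := ⟨q.1, q.2.1⟩) h1.1 h2.1
  obtain ⟨z', hz', hz'μ, hsrc'⟩ := mem_boxBonds_of_src_tgt_mem hsN a (b := ⟨q.1.shift q.2.1, q.2.2⟩) h2.1 h4.1
  simp only at hsrc hsrc' hzν hz'μ
  have heq : z + e q.2.1 = z' := by
    refine castSite_injOn_box hN (le_add_e hz _) hzν hz' ((le_add_of_nonneg_right (B8Lemma1NonAbelian.e_nonneg _)).trans hz'μ) ?_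
    rw [castSite_add_e, ← hsrc, hsrc']
  refine ⟨z, hz, ?_, hsrc⟩
  rw [add_right_comm, heq]; exact hz'μ


/-- **The plaquettes of a box lie INSIDE any site set containing the cube** (all four corners are images of box points). [cite: Balaban1988Convergent, (2.17) p.257 (bookkeeping)] -/
theorem boxPlaqs_subset_plaqInside {s : ℕ} (a : Fin P.d → ℤ) {Ω : Set (Site P 0)} (hΩ : cubeEnl P s a 0 ⊆ Ω) :
    boxPlaqs (boxLo s a) (boxHi s a) ⊆ plaqInside Ω := by
  rintro p ⟨z, hlz, hzh, hsrc⟩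
  have hmem : ∀ w : Fin P.d → ℤ, boxLo s a ≤ w → w ≤ boxHi s a → (castSite w : Site P 0) ∈ Ω := fun w h1 h2 => by
    apply hΩ; rw [cubeEnl_zero_eq]; exact ⟨w, ⟨h1, h2⟩, rfl⟩
  have hμ0 := e_apply_nonneg (d := P.d) p.μ
  have hν0 := e_apply_nonneg (d := P.d) p.ν
  have hzhi : z ≤ boxHi s a := fun i => by have := hzh i; simp only [Pi.add_apply] at this; linarith [hμ0 i, hν0 i]
  have hzμhi : z + e p.μ ≤ boxHi s a := fun i => by have := hzh i; simp only [Pi.add_apply] at this ⊢; linarith [hν0 i]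
  have hzνhi : z + e p.ν ≤ boxHi s a := fun i => by have := hzh i; simp only [Pi.add_apply] at this ⊢; linarith [hμ0 i]
  refine ⟨?_, ?_, ?_, ?_⟩
  · rw [hsrc]; exact hmem z hlz hzhi
  · rw [hsrc, ← castSite_add_e]; exact hmem _ (le_add_e hlz _) hzμhi
  · rw [hsrc, ← castSite_add_e]; exact hmem _ (le_add_e hlz _) hzνhi
  · rw [hsrc, ← castSite_add_e, ← castSite_add_e]; exact hmem _ (le_add_e (le_add_e hlz _) _) hzh

/-- **THE GRADIENT BOUND ON A CUBE OF RECORD** from the class bound `δ` on the plaquettes touching a set `Ω ⊇` the cube and the C¹ datum `δ′` on those INSIDE `Ω` (chart reachable: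
`(d−1)(s−1)δ ≤ ½`): on every derivative triple of `□ ∩ Y`, `‖∇^ξ A‖ ≤ 4(δ + (d−1)(s−1)(δ′ + 2δ·A) + 2A²)∕ξ²`, `A = (d−1)(s−1)δ`. [cite: Balaban1987RG1, (1.12) p.262; Balaban1985Variational, Thm 1 (9)–(10) p.279] -/
theorem norm_grad_axialPotential_cube_le {s : ℕ} (hsN : (s : ℤ) < P.sitesPerDir 0) (a : Fin P.d → ℤ) {Y Ω : Set (Site P 0)}
    (hΩ : cubeEnl P s a 0 ⊆ Ω) {U : GaugeField P 0 (SU N)} {δ δ' : ℝ} (hδ : 0 ≤ δ) (hδ' : 0 ≤ δ')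
    (hU : PlaqSmallOn (B8Eq17ClassAkV1.plaqsOf Ω) δ U) (hC : PlaqC1SmallOn (plaqInside Ω) δ' U)
    (hsmall : ((P.d - 1 : ℕ) : ℝ) * ((s - 1 : ℕ) : ℝ) * δ ≤ 1 / 2) {ξ : ℝ} (hξ : 0 < ξ)
    {q : Site P 0 × Fin P.d × Fin P.d} (hq : q ∈ (Sect2.regionOfSet P (cubeEnl P s a 0 ∩ Y)).dpairs) :
    ‖grad ξ q.2.1 (fun y => axialPotential U (boxLo s a) (boxHi s a) ξ ⟨y, q.2.2⟩) q.1‖ ≤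
      4 * (δ + (((P.d - 1 : ℕ) : ℝ) * ((s - 1 : ℕ) : ℝ)) * (δ' + 2 * δ * ((((P.d - 1 : ℕ) : ℝ) * ((s - 1 : ℕ) : ℝ) * δ))) +
        2 * ((((P.d - 1 : ℕ) : ℝ) * ((s - 1 : ℕ) : ℝ) * δ)) ^ 2) / ξ ^ 2 := by
  obtain ⟨z, hz, hz', hq1⟩ := exists_boxPoint_of_dpair hsN a hq
  have hnN : s - 1 < P.sitesPerDir 0 := by
    have : (s : ℤ) < P.sitesPerDir 0 := hsN
    omega
  rw [hq1]
  exact norm_grad_axialPotential_le U (subset_refl _) (fun p hp => hU p (boxPlaqs_subset_plaqsOf a hΩ hp))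
    (hC.mono (boxPlaqs_subset_plaqInside a hΩ)) hδ hδ' (boxHi_le s a) hnN hsmall hξ q.2.2 q.2.1 hz hz'

/-- The scale algebra: `4·T(δ, δ′, m)∕ξ²` at `δ = bξ²`, `δ′ = b′ξ³` is `4(b + (d−1)(mξ)b′ + 4((d−1)mξ)²b²)`, monotone in `mξ ≤ X`. [cite: Balaban1987RG1, (1.12) p.262 (bookkeeping)] -/
theorem scale_algebra {dd m ξ b b' X : ℝ} (hdd : 0 ≤ dd) (hm : 0 ≤ m) (hξ : 0 < ξ) (hb' : 0 ≤ b') (hX : m * ξ ≤ X) :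
    4 * (b * ξ ^ 2 + (dd * m) * (b' * ξ ^ 3 + 2 * (b * ξ ^ 2) * ((dd * m * (b * ξ ^ 2)))) + 2 * ((dd * m * (b * ξ ^ 2))) ^ 2) / ξ ^ 2 ≤
      4 * (b + dd * X * b' + 4 * (dd * X) ^ 2 * b ^ 2) := by
  have hξ2 : 0 < ξ ^ 2 := by positivity
  have hmξ : 0 ≤ m * ξ := mul_nonneg hm hξ.le
  have key : 4 * (b * ξ ^ 2 + (dd * m) * (b' * ξ ^ 3 + 2 * (b * ξ ^ 2) * ((dd * m * (b * ξ ^ 2)))) + 2 * ((dd * m * (b * ξ ^ 2))) ^ 2) / ξ ^ 2 =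
      4 * (b + dd * (m * ξ) * b' + 4 * (dd * (m * ξ)) ^ 2 * b ^ 2) := by
    field_simp
    ring
  rw [key]
  gcongr

/-- **★ THE (1.12) DERIVATIVE MEMBER `h3I` ON THE `O(1)LM`-CUBES OF RECORD AT SCALE `j`** (the `h3` of FILE 4's `localGauge_cubesI_of_classBound`, the `h3I` of FILE 5's
`bgRowAt_of_classBounds`∕`bgRowAt_of_thm1ScaledSep`), FROM the class bound `|∂U − 1| < b·η_j²` AND the C¹ datum `< b′·η_j³` on the plaquettes INSIDE `Ω`
(every cube meeting `Y` lies in `Ω`), chart reachability, and ONE letter `4(b + (d−1)LM·b′ + 4(d−1)²L²M²·b²) < B` (`B = O(1)LMB·α₀`).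
[cite: Balaban1987RG1, (1.12) p.262; Balaban1988Convergent, (2.27)–(2.28) p.259; Balaban1985Variational, Thm 1 (9)–(10) p.279] -/
theorem h3I_of_plaqC1 {M j : ℕ} {Y Ω : Set (Site P 0)} (hsN : ((B14.Eq213MaximalDomains.side P.L M (j + 1) : ℕ) : ℤ) < P.sitesPerDir 0)
    (hcubeΩ : ∀ a ∈ cubeIndices P (B14.Eq213MaximalDomains.side P.L M (j + 1)),
      (cubeEnl P (B14.Eq213MaximalDomains.side P.L M (j + 1)) a 0 ∩ Y).Nonempty → cubeEnl P (B14.Eq213MaximalDomains.side P.L M (j + 1)) a 0 ⊆ Ω)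
    {U : GaugeField P 0 (SU N)} {b b' : ℝ} (hb : 0 ≤ b) (hb' : 0 ≤ b')
    (hU : PlaqSmallOn (B8Eq17ClassAkV1.plaqsOf Ω) (b * P.eta j ^ 2) U) (hC : PlaqC1SmallOn (plaqInside Ω) (b' * P.eta j ^ 3) U)
    (hsmall : ((P.d - 1 : ℕ) : ℝ) * ((B14.Eq213MaximalDomains.side P.L M (j + 1) - 1 : ℕ) : ℝ) * (b * P.eta j ^ 2) ≤ 1 / 2) {B : ℝ}
    (hB : 4 * (b + ((P.d - 1 : ℕ) : ℝ) * ((P.L : ℝ) * M) * b' + 4 * (((P.d - 1 : ℕ) : ℝ) * ((P.L : ℝ) * M)) ^ 2 * b ^ 2) < B) :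
    ∀ a ∈ cubeIndices P (B14.Eq213MaximalDomains.side P.L M (j + 1)),
      (cubeEnl P (B14.Eq213MaximalDomains.side P.L M (j + 1)) a 0 ∩ Y).Nonempty →
      ∀ q ∈ (Sect2.regionOfSet P (cubeEnl P (B14.Eq213MaximalDomains.side P.L M (j + 1)) a 0 ∩ Y)).dpairs,
        ‖grad (P.eta j) q.2.1 (fun y => axialPotential U (boxLo (B14.Eq213MaximalDomains.side P.L M (j + 1)) a)
          (boxHi (B14.Eq213MaximalDomains.side P.L M (j + 1)) a) (P.eta j) ⟨y, q.2.2⟩) q.1‖ < B := by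
  intro a ha hne q hq
  have hξ : 0 < P.eta j := pow_pos (inv_pos.mpr (Nat.cast_pos.mpr P.L_pos)) j
  have h := norm_grad_axialPotential_cube_le hsN a (hcubeΩ a ha hne) (mul_nonneg hb (sq_nonneg _)) (mul_nonneg hb' (pow_nonneg hξ.le 3)) hU hC hsmall hξ hq
  refine (h.trans ?_).trans_lt hB
  have hside := side_pred_mul_eta_le (P := P) M j
  have := scale_algebra (dd := ((P.d - 1 : ℕ) : ℝ)) (m := ((B14.Eq213MaximalDomains.side P.L M (j + 1) - 1 : ℕ) : ℝ)) (b := b) (Nat.cast_nonneg _)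
    (Nat.cast_nonneg _) hξ hb' hside
  convert this using 3

/-- **★ THE (2.38) DERIVATIVE MEMBER `h3MS` ON THE LAYER CUBES OF RECORD** (the `h3` of FILE 4's `condII238_cubesMS_of_classBounds`, the `h3MS` of FILE 5), at every scale
`1 ≤ n ≤ j`, chart `ξ = η_j`, weight `(Lⁿη_j)²`: FROM the per-scale class bounds `b_n·η_n²`, C¹ data `b′_n·η_n³` on the plaquettes inside `Ω_n`, chart reachability, and the
letters `4(b_n + (d−1)M·b′_n + 4(d−1)²M²·b_n²) < rad238 B C Mr (α₀ n)`. [cite: Balaban1988Convergent, (2.38) p.261; Balaban1985Variational, Thm 1 (9)–(10) p.279] -/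
theorem h3MS_of_plaqC1 {M j : ℕ} {Y : Set (Site P 0)} {Ω : ℕ → Set (Site P 0)}
    (hsN : ∀ n, 1 ≤ n → n ≤ j → ((B14.Eq213MaximalDomains.side P.L M n : ℕ) : ℤ) < P.sitesPerDir 0)
    {U : GaugeField P 0 (SU N)} {b b' : ℕ → ℝ} (hb0 : ∀ n, 1 ≤ n → n ≤ j → 0 ≤ b n) (hb'0 : ∀ n, 1 ≤ n → n ≤ j → 0 ≤ b' n)
    (hU : ∀ n, 1 ≤ n → n ≤ j → PlaqSmallOn (B8Eq17ClassAkV1.plaqsOf (Ω n)) (b n * P.eta n ^ 2) U)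
    (hC : ∀ n, 1 ≤ n → n ≤ j → PlaqC1SmallOn (plaqInside (Ω n)) (b' n * P.eta n ^ 3) U)
    (hsmall : ∀ n, 1 ≤ n → n ≤ j → ((P.d - 1 : ℕ) : ℝ) * ((B14.Eq213MaximalDomains.side P.L M n - 1 : ℕ) : ℝ) * (b n * P.eta n ^ 2) ≤ 1 / 2)
    {B C Mr : ℝ} {α₀ : ℕ → ℝ}
    (hletter : ∀ n, 1 ≤ n → n ≤ j → 4 * (b n + ((P.d - 1 : ℕ) : ℝ) * (M : ℝ) * b' n + 4 * (((P.d - 1 : ℕ) : ℝ) * (M : ℝ)) ^ 2 * b n ^ 2) < rad238 B C Mr (α₀ n)) :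
    ∀ n, 1 ≤ n → n ≤ j → ∀ a ∈ cubeIndices P (B14.Eq213MaximalDomains.side P.L M n),
      (cubeEnl P (B14.Eq213MaximalDomains.side P.L M n) a 0 ∩ Y).Nonempty → cubeEnl P (B14.Eq213MaximalDomains.side P.L M n) a 0 ⊆ Ω n →
      ∀ q ∈ (Sect2.regionOfSet P (cubeEnl P (B14.Eq213MaximalDomains.side P.L M n) a 0 ∩ Y)).dpairs,
        ((P.L : ℝ) ^ n * P.eta j) ^ 2 * ‖grad (P.eta j) q.2.1 (fun y => axialPotential U (boxLo (B14.Eq213MaximalDomains.side P.L M n) a)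
          (boxHi (B14.Eq213MaximalDomains.side P.L M n) a) (P.eta j) ⟨y, q.2.2⟩) q.1‖ < rad238 B C Mr (α₀ n) := by
  intro n h1 hn a ha _hne hΩ q hq
  have hξ : 0 < P.eta j := pow_pos (inv_pos.mpr (Nat.cast_pos.mpr P.L_pos)) j
  have hηn : 0 < P.eta n := pow_pos (inv_pos.mpr (Nat.cast_pos.mpr P.L_pos)) n
  have h := norm_grad_axialPotential_cube_le (hsN n h1 hn) a hΩ (mul_nonneg (hb0 n h1 hn) (sq_nonneg _)) (mul_nonneg (hb'0 n h1 hn) (pow_nonneg hηn.le 3))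
    (hU n h1 hn) (hC n h1 hn) (hsmall n h1 hn) hξ hq
  have hLn : (0 : ℝ) ≤ ((P.L : ℝ) ^ n * P.eta j) ^ 2 := sq_nonneg _
  refine ((mul_le_mul_of_nonneg_left h hLn).trans ?_).trans_lt (hletter n h1 hn)
  have hside := side_pred_mul_eta_le' (P := P) M n
  have hLη := L_pow_mul_eta (P := P) n
  have halg := scale_algebra (dd := ((P.d - 1 : ℕ) : ℝ)) (m := ((B14.Eq213MaximalDomains.side P.L M n - 1 : ℕ) : ℝ)) (b := b n) (Nat.cast_nonneg _)
    (Nat.cast_nonneg _) hηn (hb'0 n h1 hn) hside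
  -- move the weight `(Lⁿη_j)²` inside: `(Lⁿη_j)²·T∕η_j² = L^{2n}·T = T′∕η_n²` with `Lⁿη_n = 1`
  have hξ2 : P.eta j ^ 2 ≠ 0 := by positivity
  have hηn2 : P.eta n ^ 2 ≠ 0 := by positivity
  set T := 4 * (b n * P.eta n ^ 2 + ((P.d - 1 : ℕ) : ℝ) * ((B14.Eq213MaximalDomains.side P.L M n - 1 : ℕ) : ℝ) *
      (b' n * P.eta n ^ 3 + 2 * (b n * P.eta n ^ 2) * (((P.d - 1 : ℕ) : ℝ) * ((B14.Eq213MaximalDomains.side P.L M n - 1 : ℕ) : ℝ) * (b n * P.eta n ^ 2))) +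
      2 * (((P.d - 1 : ℕ) : ℝ) * ((B14.Eq213MaximalDomains.side P.L M n - 1 : ℕ) : ℝ) * (b n * P.eta n ^ 2)) ^ 2) with hT
  have hT0 : 0 ≤ T := by
    have := hb0 n h1 hn; have := hb'0 n h1 hn; positivity
  have hweight : ((P.L : ℝ) ^ n * P.eta j) ^ 2 * (T / P.eta j ^ 2) = T / P.eta n ^ 2 := by
    have hL : (P.L : ℝ) ^ n = (P.eta n)⁻¹ := by
      exact eq_inv_of_mul_eq_one_left hLη
    rw [hL]; field_simp
  calc ((P.L : ℝ) ^ n * P.eta j) ^ 2 * (T / P.eta j ^ 2) = T / P.eta n ^ 2 := hweight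
    _ ≤ 4 * (b n + ((P.d - 1 : ℕ) : ℝ) * (M : ℝ) * b' n + 4 * (((P.d - 1 : ℕ) : ℝ) * (M : ℝ)) ^ 2 * b n ^ 2) := by
        convert halg using 3

end Cubes

/-! ## §5  At def-R's objects: the row's body from the two CLASS bounds (plaquette + C¹) + letters — `h3I`∕`h3MS` GONE -/

section Record

variable {F : T4Family} {N : ℕ} [NeZero N]

/-- Chart-reachability in the `(side − 1)` form from the `LM` form: `(d−1)(s−1)·bη_j² ≤ (d−1)LM·η_j·b`. [cite: Balaban1987RG1, (1.12) p.262 (bookkeeping)] -/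
theorem hsmall_side_of_LM {P : Params} (M j : ℕ) {b : ℝ} (hb : 0 ≤ b)
    (h : ((P.d - 1 : ℕ) : ℝ) * ((P.L : ℝ) * M) * P.eta j * b ≤ 1 / 2) :
    ((P.d - 1 : ℕ) : ℝ) * ((B14.Eq213MaximalDomains.side P.L M (j + 1) - 1 : ℕ) : ℝ) * (b * P.eta j ^ 2) ≤ 1 / 2 := by
  have hside := side_pred_mul_eta_le (P := P) M j
  have hη : 0 ≤ P.eta j := (pow_pos (inv_pos.mpr (Nat.cast_pos.mpr P.L_pos)) j).le
  calc ((P.d - 1 : ℕ) : ℝ) * ((B14.Eq213MaximalDomains.side P.L M (j + 1) - 1 : ℕ) : ℝ) * (b * P.eta j ^ 2)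
      = ((P.d - 1 : ℕ) : ℝ) * ((((B14.Eq213MaximalDomains.side P.L M (j + 1) - 1 : ℕ) : ℝ)) * P.eta j) * P.eta j * b := by ring
    _ ≤ ((P.d - 1 : ℕ) : ℝ) * ((P.L : ℝ) * M) * P.eta j * b := by gcongr
    _ ≤ 1 / 2 := h

/-- The same at a layer scale `n`: `(d−1)(s−1)·bη_n² ≤ (d−1)M·η_n·b` for `s = LⁿM`. [cite: Balaban1988Convergent, (2.38) p.261 (bookkeeping)] -/
theorem hsmall_side_of_M {P : Params} (M n : ℕ) {b : ℝ} (hb : 0 ≤ b)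
    (h : ((P.d - 1 : ℕ) : ℝ) * M * P.eta n * b ≤ 1 / 2) :
    ((P.d - 1 : ℕ) : ℝ) * ((B14.Eq213MaximalDomains.side P.L M n - 1 : ℕ) : ℝ) * (b * P.eta n ^ 2) ≤ 1 / 2 := by
  have hside := side_pred_mul_eta_le' (P := P) M n
  have hη : 0 ≤ P.eta n := (pow_pos (inv_pos.mpr (Nat.cast_pos.mpr P.L_pos)) n).le
  calc ((P.d - 1 : ℕ) : ℝ) * ((B14.Eq213MaximalDomains.side P.L M n - 1 : ℕ) : ℝ) * (b * P.eta n ^ 2)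
      = ((P.d - 1 : ℕ) : ℝ) * ((((B14.Eq213MaximalDomains.side P.L M n - 1 : ℕ) : ℝ)) * P.eta n) * P.eta n * b := by ring
    _ ≤ ((P.d - 1 : ℕ) : ℝ) * (M : ℝ) * P.eta n * b := by gcongr
    _ ≤ 1 / 2 := h

/-- **★★ THE ROW'S BODY AT ONE SEQUENCE `s` FROM THE TWO PER-SCALE CLASS BOUNDS** — plaquette `|∂U − 1| < b_n·η_n²` ([15] Thm 1 (8)) AND the covariant C¹ datum
`< b′_n·η_n³` on adjacent plaquettes ([15] Thm 1 (9)–(10), gauge-free reading) on def-R's background `U_k(s)(𝐖)` for retained solvable `𝐖` — plus the numerics, the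
compatibility (C1)(C2), no wrapping, and TWO scale-free letters `4(b_j + (d−1)LM·b′_j + 4(d−1)²L²M²b_j²) < O(1)LMB·α_{0,j}`, `4(b_n + (d−1)M·b′_n + 4(d−1)²M²b_n²) <
rad238·α_{0,n}`: the two guarded memberships of `BgProvisoΛ`, with NO gauge-potential hypothesis left (FILE 5's `h3I`∕`h3MS` are supplied by §4 for the axial potential of
record). [cite: Balaban1988Convergent, (2.27)–(2.28) p.259, (2.34)–(2.41) p.261; Balaban1987RG1, (1.11)–(1.16) p.262; Balaban1985Variational, Thm 1 (8)–(10) p.279] -/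
theorem bgRowAt_of_classBoundsC1 (S : Sect2.Setting (MatA N) (SU N)) (hι : S.ι = ιSU N) (h𝓜 : S.𝓜 = B12RegularSpaces111SpecialUnitary.suModel N) (hS : S.Laws)
    (hpos : S.Pos) (ν : Stage7Numerics) {M : ℕ} (hM : 0 < M) (K k : ℕ) (cR : ℝ) {b b' : ℕ → ℝ} (hb0 : ∀ n, n ≤ k → 0 ≤ b n) (hb'0 : ∀ n, n ≤ k → 0 ≤ b' n)
    (s : SeqOfRecord F ν M S.flow.g K k)
    (hclass : ∀ W : MSField (F.P K) (SU N), W ∈ regSuppOfRecord F N ν M S.flow.g K k cR s →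
      W ∈ solvableDom (avOfRecord F N K) (regMSOfRecord F N ν K k s.Ω) (genSet s.Ω k) →
      ∀ n, n ≤ k → PlaqSmallOn (omegaPlaqs s.Ω n) (b n * (F.P K).eta n ^ 2) (UbgMSOfRecord F N ν M S.flow.g K k s W))
    (hclassC1 : ∀ W : MSField (F.P K) (SU N), W ∈ regSuppOfRecord F N ν M S.flow.g K k cR s →
      W ∈ solvableDom (avOfRecord F N K) (regMSOfRecord F N ν K k s.Ω) (genSet s.Ω k) →
      ∀ n, 1 ≤ n → n ≤ k → PlaqC1SmallOn (plaqInside (s.Ω n)) (b' n * (F.P K).eta n ^ 3) (UbgMSOfRecord F N ν M S.flow.g K k s W))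
    (hα : ∀ n, 1 ≤ n → n ≤ k → 0 < S.lf.alpha0 (S.flow.g n) ∧ 0 < S.lf.alpha1 (S.flow.g n))
    (hbα : ∀ n, 1 ≤ n → n ≤ k → b n ≤ (1 - S.βc) * S.lf.alpha0 (S.flow.g n))
    (hsN : ∀ n, 1 ≤ n → n ≤ k + 1 → ((B14.Eq213MaximalDomains.side (F.P K).L M n : ℕ) : ℤ) < (F.P K).sitesPerDir 0)
    (hcB : 2 * (((F.P K).d - 1 : ℕ) : ℝ) * ((F.P K).L * M) < S.cB) (hBCM : 2 * (((F.P K).d - 1 : ℕ) : ℝ) * M < S.B * S.C * S.Mr)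
    (hsmallI : ∀ j, 1 ≤ j → j ≤ k → (((F.P K).d - 1 : ℕ) : ℝ) * ((F.P K).L * M) * (F.P K).eta j * b j ≤ 1 / 2)
    (hsmallMS : ∀ n, 1 ≤ n → n ≤ k → (((F.P K).d - 1 : ℕ) : ℝ) * M * (F.P K).eta n * b n ≤ 1 / 2)
    (hC1 : ∀ j, 1 ≤ j → j ≤ k → ∃ t : ℕ, 0 < t ∧ RkOfRecord (F.P K).L ν.r (S.flow.g j) = (F.P K).L * t)
    (hC2 : ∀ j, 1 ≤ j → j ≤ k → dCubeSide (F.P K).L M (RkOfRecord (F.P K).L ν.r (S.flow.g j)) j ∣ (F.P K).sitesPerDir 0)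
    (hletterI : ∀ j, 1 ≤ j → j ≤ k →
      4 * (b j + (((F.P K).d - 1 : ℕ) : ℝ) * (((F.P K).L : ℝ) * M) * b' j + 4 * ((((F.P K).d - 1 : ℕ) : ℝ) * (((F.P K).L : ℝ) * M)) ^ 2 * b j ^ 2) <
        S.cB * S.lf.alpha0 (S.flow.g j))
    (hletterMS : ∀ n, 1 ≤ n → n ≤ k →
      4 * (b n + (((F.P K).d - 1 : ℕ) : ℝ) * (M : ℝ) * b' n + 4 * ((((F.P K).d - 1 : ℕ) : ℝ) * (M : ℝ)) ^ 2 * b n ^ 2) < rad238 S.B S.C S.Mr (S.lf.alpha0 (S.flow.g n))) :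
    ∀ W : MSField (F.P K) (SU N), W ∈ regSuppOfRecord F N ν M S.flow.g K k cR s → ∀ j, 1 ≤ j → j ≤ k → ∀ X : (Sect2.domSys (F.P K) M j).Dom,
      (Sect2.domSites (F.P K) M j X ⊆ s.Λ j →
        Sect2.ofBackgroundC S.ι (UbgMSOfRecord F N ν M S.flow.g K k s W) ∈
          Sect2.spaceI S (Sect2.Residual.unit (F.P K) (MatA N)) M j (Sect2.domSites (F.P K) M j X) (S.lf.alpha0 (S.flow.g j)) (S.lf.alpha1 (S.flow.g j))) ∧
      (Sect2.admB (F.P K) ν M S.flow.g s.Ω s.Λ j (Sect2.domSites (F.P K) M j X) = true →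
        Sect2.ofBackgroundC S.ι (UbgMSOfRecord F N ν M S.flow.g K k s W) ∈
          Sect2.spaceMS S (Sect2.Residual.unit (F.P K) (MatA N)) M j (Sect2.domSites (F.P K) M j X) s.Ω) := by
  refine bgRowAt_of_classBounds S hι h𝓜 hS hpos ν hM K k cR hb0 s hclass hα hbα hsN hcB hBCM hsmallI hsmallMS hC1 hC2 ?_ ?_
  · intro W hW hsol j h1 hjk X hX
    have hclassj : PlaqSmallOn (B8Eq17ClassAkV1.plaqsOf (s.Ω j)) (b j * (F.P K).eta j ^ 2) (UbgMSOfRecord F N ν M S.flow.g K k s W) := by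
      have := hclass W hW hsol j hjk
      rwa [omegaPlaqs_of_ne_zero _ (Nat.one_le_iff_ne_zero.mp h1)] at this
    exact h3I_of_plaqC1 (hsN (j + 1) (by omega) (by omega)) (hcubeΩ_of_compatible ν hM S.flow.g K k s hC1 hC2 j h1 hjk X hX) (hb0 j hjk) (hb'0 j hjk)
      hclassj (hclassC1 W hW hsol j h1 hjk) (hsmall_side_of_LM M j (hb0 j hjk) (hsmallI j h1 hjk)) (hletterI j h1 hjk)
  · intro W hW hsol j h1 hjk X n hn1 hnj
    refine h3MS_of_plaqC1 (j := j) (Y := Sect2.domSites (F.P K) M j X) (fun n hn1 hnj => hsN n hn1 (by omega)) (fun n _ hnj => hb0 n (by omega))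
      (fun n _ hnj => hb'0 n (by omega)) (fun n hn1 hnj => ?_) (fun n hn1 hnj => hclassC1 W hW hsol n hn1 (by omega))
      (fun n hn1 hnj => hsmall_side_of_M M n (hb0 n (by omega)) (hsmallMS n hn1 (by omega))) (fun n hn1 hnj => hletterMS n hn1 (by omega)) n hn1 hnj
    have := hclass W hW hsol n (by omega)
    rwa [omegaPlaqs_of_ne_zero _ (Nat.one_le_iff_ne_zero.mp hn1)] at this

/-- **★★★ THE FAITHFUL CHAIN WITH THE GAUGE HALF REDUCED TO A CLASS BOUND** — the row's body AT EVERY SEPARATED SEQUENCE with comparable thresholds, from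
`VariationalThm1ScaledSep` ([15] Thm 1 (8), per-scale, print's sequences) for the plaquette class bound `B₃·cR·ε_n·η_n²`, ONE displayed C¹ class datum
`B₃′·cR·ε_n·η_n³` on adjacent plaquettes of def-R's background ([15] Thm 1 (9)–(10), gauge-free reading — `hclassC1`), the numerics, (C1)(C2), no wrapping, and the two
scale-free letters.  Compared with FILE 5 v1.2 `bgRowAt_of_thm1ScaledSep`, the hypotheses `h3I`∕`h3MS` on the gradient of the axial potential are GONE. [cite: Balaban1985Variational, Thm 1 (8)–(10) p.279; Balaban1985RegularSpaces, (1.3)–(1.8) p.77; Balaban1988Convergent, (2.7)–(2.8) pp.255–256, (2.27)–(2.28) p.259, (2.34)–(2.41) p.261; Balaban1987RG1, (1.11)–(1.16) p.262] -/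
theorem bgRowAt_of_thm1ScaledSepC1 {B₃ B₃' a₀ a₁ : ℝ} (h15 : VariationalThm1ScaledSep F N B₃ a₀ a₁)
    (S : Sect2.Setting (MatA N) (SU N)) (hι : S.ι = ιSU N) (h𝓜 : S.𝓜 = B12RegularSpaces111SpecialUnitary.suModel N) (hS : S.Laws) (hpos : S.Pos)
    (ν : Stage7Numerics) {M : ℕ} (hM : 0 < M) (K k : ℕ) (cR : ℝ) (hB₃ : 0 ≤ B₃) (hB₃' : 0 ≤ B₃')
    (hnum : ∀ n, n ≤ k → 0 < cR * epsOfRecord ν S.flow.g n ∧ cR * epsOfRecord ν S.flow.g n ≤ a₁ ∧ B₃ * (cR * epsOfRecord ν S.flow.g n) ≤ ν.εreg)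
    (ha₀ : ν.εreg ≤ a₀) (hcomp : ∀ n, n < k → cR * epsOfRecord ν S.flow.g n ≤ 2 * (cR * epsOfRecord ν S.flow.g (n + 1)))
    (hα : ∀ n, 1 ≤ n → n ≤ k → 0 < S.lf.alpha0 (S.flow.g n) ∧ 0 < S.lf.alpha1 (S.flow.g n))
    (hBα : ∀ n, 1 ≤ n → n ≤ k → B₃ * (cR * epsOfRecord ν S.flow.g n) ≤ (1 - S.βc) * S.lf.alpha0 (S.flow.g n))
    (hsN : ∀ n, 1 ≤ n → n ≤ k + 1 → ((B14.Eq213MaximalDomains.side (F.P K).L M n : ℕ) : ℤ) < (F.P K).sitesPerDir 0)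
    (hcB : 2 * (((F.P K).d - 1 : ℕ) : ℝ) * ((F.P K).L * M) < S.cB) (hBCM : 2 * (((F.P K).d - 1 : ℕ) : ℝ) * M < S.B * S.C * S.Mr)
    (hsmallI : ∀ j, 1 ≤ j → j ≤ k → (((F.P K).d - 1 : ℕ) : ℝ) * ((F.P K).L * M) * (F.P K).eta j * (B₃ * (cR * epsOfRecord ν S.flow.g j)) ≤ 1 / 2)
    (hsmallMS : ∀ n, 1 ≤ n → n ≤ k → (((F.P K).d - 1 : ℕ) : ℝ) * M * (F.P K).eta n * (B₃ * (cR * epsOfRecord ν S.flow.g n)) ≤ 1 / 2)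
    (hC1 : ∀ j, 1 ≤ j → j ≤ k → ∃ t : ℕ, 0 < t ∧ RkOfRecord (F.P K).L ν.r (S.flow.g j) = (F.P K).L * t)
    (hC2 : ∀ j, 1 ≤ j → j ≤ k → dCubeSide (F.P K).L M (RkOfRecord (F.P K).L ν.r (S.flow.g j)) j ∣ (F.P K).sitesPerDir 0)
    (s : SeqOfRecord F ν M S.flow.g K k) (hsep : Sect2.SeqSeparated ν.M₁ s)
    (hclassC1 : ∀ W : MSField (F.P K) (SU N), W ∈ regSuppOfRecord F N ν M S.flow.g K k cR s →
      W ∈ solvableDom (avOfRecord F N K) (regMSOfRecord F N ν K k s.Ω) (genSet s.Ω k) →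
      ∀ n, 1 ≤ n → n ≤ k →
        PlaqC1SmallOn (plaqInside (s.Ω n)) (B₃' * (cR * epsOfRecord ν S.flow.g n) * (F.P K).eta n ^ 3) (UbgMSOfRecord F N ν M S.flow.g K k s W))
    (hletterI : ∀ j, 1 ≤ j → j ≤ k →
      4 * (B₃ * (cR * epsOfRecord ν S.flow.g j) + (((F.P K).d - 1 : ℕ) : ℝ) * (((F.P K).L : ℝ) * M) * (B₃' * (cR * epsOfRecord ν S.flow.g j)) +
        4 * ((((F.P K).d - 1 : ℕ) : ℝ) * (((F.P K).L : ℝ) * M)) ^ 2 * (B₃ * (cR * epsOfRecord ν S.flow.g j)) ^ 2) < S.cB * S.lf.alpha0 (S.flow.g j))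
    (hletterMS : ∀ n, 1 ≤ n → n ≤ k →
      4 * (B₃ * (cR * epsOfRecord ν S.flow.g n) + (((F.P K).d - 1 : ℕ) : ℝ) * (M : ℝ) * (B₃' * (cR * epsOfRecord ν S.flow.g n)) +
        4 * ((((F.P K).d - 1 : ℕ) : ℝ) * (M : ℝ)) ^ 2 * (B₃ * (cR * epsOfRecord ν S.flow.g n)) ^ 2) < rad238 S.B S.C S.Mr (S.lf.alpha0 (S.flow.g n))) :
    ∀ W : MSField (F.P K) (SU N), W ∈ regSuppOfRecord F N ν M S.flow.g K k cR s → ∀ j, 1 ≤ j → j ≤ k → ∀ X : (Sect2.domSys (F.P K) M j).Dom,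
      (Sect2.domSites (F.P K) M j X ⊆ s.Λ j →
        Sect2.ofBackgroundC S.ι (UbgMSOfRecord F N ν M S.flow.g K k s W) ∈
          Sect2.spaceI S (Sect2.Residual.unit (F.P K) (MatA N)) M j (Sect2.domSites (F.P K) M j X) (S.lf.alpha0 (S.flow.g j)) (S.lf.alpha1 (S.flow.g j))) ∧
      (Sect2.admB (F.P K) ν M S.flow.g s.Ω s.Λ j (Sect2.domSites (F.P K) M j X) = true →
        Sect2.ofBackgroundC S.ι (UbgMSOfRecord F N ν M S.flow.g K k s W) ∈
          Sect2.spaceMS S (Sect2.Residual.unit (F.P K) (MatA N)) M j (Sect2.domSites (F.P K) M j X) s.Ω) :=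
  bgRowAt_of_classBoundsC1 S hι h𝓜 hS hpos ν hM K k cR (fun n hn => mul_nonneg hB₃ (hnum n hn).1.le) (fun n hn => mul_nonneg hB₃' (hnum n hn).1.le) s
    (fun _ hW hsol => plaqSmallOn_UbgMSOfRecord_of_thm1ScaledSep h15 ν M S.flow.g K k cR s hsep hnum ha₀ hcomp hW hsol)
    hclassC1 hα hBα hsN hcB hBCM hsmallI hsmallMS hC1 hC2 hletterI hletterMS

end Record

end Literature.MathematicalPhysics.QuantumFieldTheory.Balaban1983to89.Node00

end
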